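import Literature.AnabelianGeometry.EtaleTheta.FrobenioidThetaOfBiKummerData
import Literature.AnabelianGeometry.EtaleTheta.FrobenioidThetaTower
import Literature.AnabelianGeometry.EtaleTheta.ThetaSystems

/-!
# [EtTh] §5 at ALL levels, assembled: the tower of roots over a §2 `ThetaEnvTower` (Rmk. 4.3.2, pp. 318–319; §5 pp. 330–331 / PDF pp. 92–93, 104–105)

Mochizuki, *The étale theta function …*, Publ. RIMS **45** (2009)
[cite: MochizukiEtTh2009, Rmk 4.3.2 p.318–319 (PDF pp.92–93); §5 p.330–331 (PDF pp.104–105)].  Seat abc-iut-L2-t4 (§5 owner), merge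
row W3-L2-01 «§5 GENUINE DATA» (MERGE-PLAN row 14), sequel of `FrobenioidThetaOfBiKummerData.lean` (p417743).  ADDITIVE.

"By allowing `N` to vary, we obtain a compatible system of roots" (Rmk. 4.3.2, p.319 (PDF p.93)); the proof of Thm. 5.7 (p.330
(PDF p.104)) runs "by considering compatible systems as in Remark 4.3.2".  abc-iut-L2-t4's `ThetaFrobenioidTower` (p414149) is the
§5 data at all levels as a free hypothesis structure; abc-iut-L2-d4's all-levels Thm. 5.7 discharges (`Discharge/Sec5Thm57Tower.lean`,
`…Constants.lean`) take `∀ N` hypotheses such as `(𝔗.atLevel N).BiKummerDifferenceMem`.  This file ASSEMBLES the tower —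
`ThetaFrobenioidTower.ofBiKummerFamily` — from: abc-iut-L2-t3's §4 setting `S`, an `l`-th root datum `Rl` of `Θ̈` and a FAMILY
`R N` (`N ≥ 1`) of `N`-th root data of its fraction-pair (Prop. 4.2 (iii) for every `N`), the level-free tempered groups of a §2
TOWER `𝒯 : ThetaEnvTower E` of abc-iut-L2-t2 (Cor. 2.19 (ii); `Π^tp_X̲`, `Π^tp_Y̲`, `Π^tp_Ÿ̲` are the same at every level),
sections `σ N`, constants, and the Rmk. 4.3.2 TRANSITIONS `(α_{N,N'}, β_{N,N'})` with their printed properties as inputs.  Each level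
is `levelData N` — the §5 data with `s^⊓-gp_N, s^⊔-gp_N :=` the unique lifts of p.331 (as in `ofRootData`) — and for `M ∈ E` it IS
`ofBiKummerData … (T := 𝒯.level M) (R M) …` DEFINITIONALLY (`levelData_eq_ofBiKummerData`), so every theorem about the assembled
level data (Prop. 4.3 (iii), `Facts`, Prop. 5.2 (i), abc-iut-w5-d123's / abc-iut-L6-t23's carrier theorems) applies to the tower's
levels; the defining relations and the section property hold at EVERY level (`sgpCapSpec_levelData`, …).
NOT done here (honest): the transitions are INPUTS (abc-iut-L2-t3's `NthRoot` carries no "morphism of roots", Rmk. 4.3.2 being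
documentation there); `ρ_comm_β` (outer equivariance of the Galois actions along `β^bs`) is a naturality input on the setting's
`galoisSurj`; nothing asserts such data exist for an actual curve; typed ≠ proved; no side taken downstream.
-/

noncomputable section

namespace Literature.AnabelianGeometry.EtaleTheta

open CategoryTheory Opposite Literature.AlgebraicGeometry.Frobenioids

universe u₀ v₀ u v w

/-! ## The level-free `Π^tp_X ↠ l·ℤ` of a §2 tower -/

namespace ThetaEnvTower

variable {E : Set ℕ+} (𝒯 : ThetaEnvTower.{v} E)

/-- `Π^tp_X ↠ Π^tp_X/Π^tp_Y ⥲ ℤ` of the tower ("`Gal(Y/X) (≅ l·ℤ)`", Def. 2.13 (i), p.273 (PDF p.47)) — definitionally the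
`ThetaEnvData.zquot` of every level `𝒯.level M`.  [cite: MochizukiEtTh2009, Def 2.13 (i) p.273 (PDF p.47)] -/
def zquot : 𝒯.PiX →* Multiplicative ℤ :=
  haveI := 𝒯.PiY_normal
  𝒯.galYX.toMonoidHom.comp (QuotientGroup.mk' 𝒯.PiY)

/-- The tower's `zquot` is each level's. [cite: MochizukiEtTh2009, Def 2.13 (i) p.273 (PDF p.47)] -/
theorem zquot_eq_level (M : E) : 𝒯.zquot = (𝒯.level M).zquot := rfl

/-- `Ker(Π^tp_X ↠ ℤ) = Π^tp_Y`. [cite: MochizukiEtTh2009, Def 2.13 (i) p.273 (PDF p.47)] -/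
theorem ker_zquot : 𝒯.zquot.ker = 𝒯.PiY :=
  ThetaEnvData.ker_zquot (𝒯.level ⟨1, 𝒯.one_mem⟩)

/-- `Π^tp_X ↠ ℤ` is onto. [cite: MochizukiEtTh2009, Def 2.13 (i) p.273 (PDF p.47)] -/
theorem zquot_surjective : Function.Surjective 𝒯.zquot :=
  ThetaEnvData.zquot_surjective (𝒯.level ⟨1, 𝒯.one_mem⟩)

end ThetaEnvTower

namespace ThetaFrobenioidTower

variable {K : Type u₀} [Field K] {X : SemiGraphs.TemperedArithmeticGroup.{u₀} K} {D₀ : Type u₀} [Category.{v₀} D₀]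
  {V : FrdIMonoidStub.{w}} {T₀ : RealifiedDivisorMonoids (D₀ := D₀) V} {D : Type u} [Category.{v} D]
  {VD : FrdICatStub.{u, v, w} D} {S : BiKummerSetting X T₀ D VD}
  {pullFrac : ∀ {A A' : S.C} (_ : A' ⟶ A), S.biratUnits A → S.biratUnits A'}
  {lv : ℕ+} {E : Set ℕ+} {𝒯 : ThetaEnvTower.{max v w} E} {θ : S.biratUnits S.Aodot} {Bl : S.C}
  {Pl : S.FractionPair θ Bl} {Rl : S.NthRoot θ Pl lv pullFrac}

section Rho

variable (R : ∀ N : ℕ+, S.NthRoot Rl.root Rl.pair N pullFrac) (ιX : 𝒯.PiX ≃ₜ* X.Pi)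

/-- The Galois action `ρ_N : Π^tp_X ↠ Aut_D(B_N^bs)` at every level (p.331 (PDF p.105)): the setting's action on the Galois object
`A_N^bs` transported along `(s^⊓_N)^bs` — for `M ∈ E` definitionally `rhoOfBiKummerData (R M) ιX` over `𝒯.level M`.
[cite: MochizukiEtTh2009, §5 p.331 (PDF p.105)] -/
def rhoFamily (N : ℕ+) : 𝒯.PiX →* Aut (R N).BN.base :=
  (BiKummerSetting.NthRoot.baseIso S (R N)).conjAut.toMonoidHom.comp
    ((S.galoisSurj (R N).AN.base (R N).αData.isGalois).comp ιX.toMulEquiv.toMonoidHom)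

/-- `rhoFamily` at `M ∈ E` is `rhoOfBiKummerData` over the level `𝒯.level M`. [cite: MochizukiEtTh2009, §5 p.331 (PDF p.105)] -/
theorem rhoFamily_eq (M : E) :
    rhoFamily R ιX M = ThetaFrobenioid.rhoOfBiKummerData (T := 𝒯.level M) (R M) ιX := rfl

/-- `ρ_N(y) = (s^⊓_N)^bs ∘ ρ_{A_N}(ιX y) ∘ ((s^⊓_N)^bs)⁻¹`. [cite: MochizukiEtTh2009, §5 p.331 (PDF p.105)] -/
theorem rhoFamily_apply (N : ℕ+) (y : 𝒯.PiX) :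
    rhoFamily R ιX N y =
      (BiKummerSetting.NthRoot.baseIso S (R N)).conjAut (S.galoisSurj (R N).AN.base (R N).αData.isGalois (ιX y)) := rfl

/-- `ρ_N` is surjective. [cite: MochizukiEtTh2009, Def 4.1 (ii) p.313 (PDF p.87)] -/
theorem rhoFamily_surjective (N : ℕ+) : Function.Surjective (rhoFamily R ιX N) :=
  (BiKummerSetting.NthRoot.baseIso S (R N)).conjAut.surjective.comp
    ((S.galoisSurj_surjective (R N).AN.base (R N).αData.isGalois).comp ιX.toMulEquiv.surjective)

/-- `Ker ρ_N` is open (input: for `A_N^bs`). [cite: MochizukiEtTh2009, §4 p.312 (PDF p.86)] -/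
theorem isOpen_ker_rhoFamily (N : ℕ+) (hopen : IsOpen ((S.galoisSurj (R N).AN.base (R N).αData.isGalois).ker : Set X.Pi)) :
    IsOpen ((rhoFamily R ιX N).ker : Set 𝒯.PiX) := by
  have hker : ((rhoFamily R ιX N).ker : Set 𝒯.PiX) =
      ιX ⁻¹' ((S.galoisSurj (R N).AN.base (R N).αData.isGalois).ker : Set X.Pi) := by
    ext y
    rw [SetLike.mem_coe, MonoidHom.mem_ker, Set.mem_preimage, SetLike.mem_coe, MonoidHom.mem_ker, rhoFamily_apply,
      MulEquiv.map_eq_one_iff]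
  rw [hker]
  exact hopen.preimage ιX.continuous

end Rho

variable (h : ModelFrobenioid.Hypotheses S.tf.divisorMonoid S.tf.ratFnFunctor)
  (toB : ∀ A : S.C, S.biratUnits A →* S.tf.biratUnitsModel A) (Q : FrobenioidTheta.ThetaSubquotientStub.{w} D)
  (odd_l : Odd (lv : ℕ)) (R : ∀ N : ℕ+, S.NthRoot Rl.root Rl.pair N pullFrac) (ιX : 𝒯.PiX ≃ₜ* X.Pi)
  (hopen : ∀ N : ℕ+, IsOpen ((S.galoisSurj (R N).AN.base (R N).αData.isGalois).ker : Set X.Pi))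
  (σ : ∀ N : ℕ+, Aut (R N).AN.base →* Aut (R N).AN)
  (K' : Type w) [Field K'] (constEmb : ∀ N : ℕ+, K'ˣ →* S.tf.biratUnitsModel (R N).BN)
  (constEmb_injective : ∀ N : ℕ+, Function.Injective (constEmb N))
  (hdivc : ∀ (N : ℕ+) (g : Aut (R N).BN.base),
    ModelFrobenioid.div ((σ N ((BiKummerSetting.NthRoot.baseIso S (R N)).conjAut.symm g)).hom ≫ (R N).pair.num) =
      ModelFrobenioid.div (R N).pair.num)
  (hdivp : ∀ (N : ℕ+) (y : 𝒯.PiYdd),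
    ModelFrobenioid.div ((σ N (S.galoisSurj (R N).AN.base (R N).αData.isGalois (ιX y.1))).hom ≫ (R N).pair.den) =
      ModelFrobenioid.div (R N).pair.den)

/-- Auxiliary level-`N` data with placeholder sections (cf. `ThetaFrobenioid.ofRootData.aux`; never a §5 datum in its own right).
[cite: MochizukiEtTh2009, §5 p.331 (PDF p.105)] -/
def levelAux (N : ℕ+) : ThetaFrobenioid.{w} S.C D where
  toTemperedFrobenioidStub := S.sec5Stub h
  toThetaSubquotientStub := Q
  l := lv
  odd_l := odd_l
  N := N
  Acirc := S.Aodot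
  AN := (R N).AN
  BN := (R N).BN
  sCap := (R N).pair.num
  sCup := (R N).pair.den
  base_map_sCap := (R N).pair.base_eq
  isPreStep_sCap := ⟨(R N).pair.isPreStep_num.1, (R N).pair.isPreStep_num.2⟩
  isPreStep_sCup := ⟨(R N).pair.isPreStep_den.1, (R N).pair.isPreStep_den.2⟩
  PiX := 𝒯.PiX
  zquot := 𝒯.zquot
  zquot_surjective := 𝒯.zquot_surjective
  PiYdd := 𝒯.PiYdd
  PiYdd_le := 𝒯.ker_zquot.symm ▸ 𝒯.PiYdd_le
  relindex_PiYdd := by rw [𝒯.ker_zquot]; exact 𝒯.index_PiYdd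
  PiYdd_normal := 𝒯.PiYdd_normal
  isOpen_PiYdd := 𝒯.PiYdd_open
  ρ := rhoFamily R ιX N
  ρ_surjective := rhoFamily_surjective R ιX N
  isOpen_ker_ρ := isOpen_ker_rhoFamily R ιX N (hopen N)
  strv := σ N
  sgpCap := 1
  sgpCup := 1
  K := K'
  constEmb := constEmb N
  constEmb_injective := constEmb_injective N
  thetaFn := toB S.Aodot θ

include hdivp in
/-- The `H_{B_N}`-form of the divisor-invariance clause `hdivp` over the auxiliary data (for `liftAlong` on `H_{B_N}`).
[cite: MochizukiEtTh2009, Prop 4.3 (i) p.317 (PDF p.91)] -/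
theorem div_levelAux_HB (N : ℕ+) (hh : (levelAux h toB Q odd_l R ιX hopen σ K' constEmb constEmb_injective N).HB) :
    (S.sec5Stub h).pre.div
        (((((levelAux h toB Q odd_l R ιX hopen σ K' constEmb constEmb_injective N).strv.comp
            (levelAux h toB Q odd_l R ιX hopen σ K' constEmb constEmb_injective N).autBaseIsoAB.symm.toMonoidHom).comp
          (levelAux h toB Q odd_l R ιX hopen σ K' constEmb constEmb_injective N).HB.subtype) hh).hom ≫ (R N).pair.den) =
      (S.sec5Stub h).pre.div (R N).pair.den := by
  obtain ⟨_, y, hy, rfl⟩ := hh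
  change (S.sec5Stub h).pre.div ((σ N ((BiKummerSetting.NthRoot.baseIso S (R N)).conjAut.symm
    ((BiKummerSetting.NthRoot.baseIso S (R N)).conjAut
      (S.galoisSurj (R N).AN.base (R N).αData.isGalois (ιX y))))).hom ≫ (R N).pair.den) = _
  rw [MulEquiv.symm_apply_apply]
  exact hdivp N ⟨y, hy⟩

/-- **The level-`N` §5 data of the assembled tower**: `(A_N, B_N, s^⊓_N, s^⊔_N)` from the root `R N`, tempered groups of the §2
tower `𝒯`, `ρ_N := rhoFamily`, `s^trv_N := σ N`, and `s^⊓-gp_N, s^⊔-gp_N :=` the unique lifts of p.331 (PDF p.105)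
(`liftAlong`; existence inputs [FrdI] Thm. 5.2 (ii) via `ModelFrobenioid.Hypotheses` and `hdivc`/`hdivp`).  For `M ∈ E` this IS
`ofBiKummerData … (T := 𝒯.level M) (R M) …` (`levelData_eq_ofBiKummerData`).  [cite: MochizukiEtTh2009, §5 p.330–331 (PDF pp.104–105)] -/
def levelData (N : ℕ+) : ThetaFrobenioid.{w} S.C D where
  toTemperedFrobenioidStub := S.sec5Stub h
  toThetaSubquotientStub := Q
  l := lv
  odd_l := odd_l
  N := N
  Acirc := S.Aodot
  AN := (R N).AN
  BN := (R N).BN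
  sCap := (R N).pair.num
  sCup := (R N).pair.den
  base_map_sCap := (R N).pair.base_eq
  isPreStep_sCap := ⟨(R N).pair.isPreStep_num.1, (R N).pair.isPreStep_num.2⟩
  isPreStep_sCup := ⟨(R N).pair.isPreStep_den.1, (R N).pair.isPreStep_den.2⟩
  PiX := 𝒯.PiX
  zquot := 𝒯.zquot
  zquot_surjective := 𝒯.zquot_surjective
  PiYdd := 𝒯.PiYdd
  PiYdd_le := 𝒯.ker_zquot.symm ▸ 𝒯.PiYdd_le
  relindex_PiYdd := by rw [𝒯.ker_zquot]; exact 𝒯.index_PiYdd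
  PiYdd_normal := 𝒯.PiYdd_normal
  isOpen_PiYdd := 𝒯.PiYdd_open
  ρ := rhoFamily R ιX N
  ρ_surjective := rhoFamily_surjective R ιX N
  isOpen_ker_ρ := isOpen_ker_rhoFamily R ιX N (hopen N)
  strv := σ N
  sgpCap :=
    ThetaFrobenioid.liftAlong
      (𝔉 := levelAux h toB Q odd_l R ιX hopen σ K' constEmb constEmb_injective N)
      (ThetaFrobenioid.epi_of_model (DivB := S.tf.divBNatTrans) h)
      (ModelFrobenioid.ofModel_isOfIsotropicType S.tf.divisorMonoid S.tf.ratFnFunctor S.tf.divBNatTrans h.isGroupLike_rat)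
      (ThetaFrobenioid.iiid_sec5Stub h)
      ((levelAux h toB Q odd_l R ιX hopen σ K' constEmb constEmb_injective N).strv.comp
        (levelAux h toB Q odd_l R ιX hopen σ K' constEmb constEmb_injective N).autBaseIsoAB.symm.toMonoidHom)
      ⟨(R N).pair.isPreStep_num.1, (R N).pair.isPreStep_num.2⟩ (fun g => hdivc N g)
  sgpCup :=
    ThetaFrobenioid.liftAlong
      (𝔉 := levelAux h toB Q odd_l R ιX hopen σ K' constEmb constEmb_injective N)
      (ThetaFrobenioid.epi_of_model (DivB := S.tf.divBNatTrans) h)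
      (ModelFrobenioid.ofModel_isOfIsotropicType S.tf.divisorMonoid S.tf.ratFnFunctor S.tf.divBNatTrans h.isGroupLike_rat)
      (ThetaFrobenioid.iiid_sec5Stub h)
      (((levelAux h toB Q odd_l R ιX hopen σ K' constEmb constEmb_injective N).strv.comp
        (levelAux h toB Q odd_l R ιX hopen σ K' constEmb constEmb_injective N).autBaseIsoAB.symm.toMonoidHom).comp
        (levelAux h toB Q odd_l R ιX hopen σ K' constEmb constEmb_injective N).HB.subtype)
      ⟨(R N).pair.isPreStep_den.1, (R N).pair.isPreStep_den.2⟩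
      (div_levelAux_HB h toB Q odd_l R ιX hopen σ K' constEmb constEmb_injective hdivp N)
  K := K'
  constEmb := constEmb N
  constEmb_injective := constEmb_injective N
  thetaFn := toB S.Aodot θ

/-- **At `M ∈ E` the tower's level data IS the assembled §5 data `ofBiKummerData` over the level `𝒯.level M`** (definitionally) —
so every theorem about `ofBiKummerData` (Prop. 4.3 (iii), `Facts`, Prop. 5.2 (i), the carrier theorems of the §5 sub-DAGs) applies to
the tower's levels.  [cite: MochizukiEtTh2009, §5 p.330–331 (PDF pp.104–105)] -/
theorem levelData_eq_ofBiKummerData (M : E) :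
    levelData h toB Q odd_l R ιX hopen σ K' constEmb constEmb_injective hdivc hdivp M =
      ThetaFrobenioid.ofBiKummerData (T := 𝒯.level M) h toB Q odd_l (R M) ιX (hopen M) (σ M) K' (constEmb M)
        (constEmb_injective M) (hdivc M) (hdivp M) := rfl

section Transitions

variable
  (α : ∀ {N N' : ℕ+}, (N : ℕ) ∣ N' → ((R N').AN ⟶ (R N).AN))
  (β : ∀ {N N' : ℕ+}, (N : ℕ) ∣ N' → ((R N').BN ⟶ (R N).BN))
  (comm_sCap : ∀ {N N' : ℕ+} (hd : (N : ℕ) ∣ N'), (R N').pair.num ≫ β hd = α hd ≫ (R N).pair.num)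
  (comm_sCup : ∀ {N N' : ℕ+} (hd : (N : ℕ) ∣ N'), (R N').pair.den ≫ β hd = α hd ≫ (R N).pair.den)
  (isIsometry_α : ∀ {N N' : ℕ+} (hd : (N : ℕ) ∣ N'), (S.sec5Stub h).pre.IsIsometry (α hd))
  (degFr_α : ∀ {N N' : ℕ+} (hd : (N : ℕ) ∣ N'), ((S.sec5Stub h).pre.degFr (α hd) : ℕ) * N = N')
  (isIsometry_β : ∀ {N N' : ℕ+} (hd : (N : ℕ) ∣ N'), (S.sec5Stub h).pre.IsIsometry (β hd))
  (degFr_β : ∀ {N N' : ℕ+} (hd : (N : ℕ) ∣ N'), ((S.sec5Stub h).pre.degFr (β hd) : ℕ) * N = N')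
  (baseFrob_α : ∀ {N N' : ℕ+} (hd : (N : ℕ) ∣ N'), S.IsOfBaseFrobeniusType (α hd))
  (ρ_comm_β : ∀ {N N' : ℕ+} (hd : (N : ℕ) ∣ N'), ∃ x : 𝒯.PiX, ∀ g : 𝒯.PiX,
    (rhoFamily R ιX N' g).hom ≫ ModelFrobenioid.baseMap (β hd) =
      ModelFrobenioid.baseMap (β hd) ≫ (rhoFamily R ιX N (x * g * x⁻¹)).hom)

/-- **[EtTh] §5 at all levels, ASSEMBLED** (W3-L2-01, MERGE-PLAN row 14): the `ThetaFrobenioidTower S.C D` whose level-free part is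
the setting's tempered Frobenioid (`sec5Stub`), `A_⊚ := S.Aodot`, the tempered groups of the §2 tower `𝒯` (same at every level),
`Θ̈ := toB θ`; whose level-`N` data are `levelData N` (roots `R N`, `ρ_N := rhoFamily`, `s^trv_N := σ N`, `s^⊓-gp_N, s^⊔-gp_N :=` the
unique lifts of p.331 (PDF p.105)); and whose Rmk. 4.3.2 transitions `(α_{N,N'}, β_{N,N'})` with the two commutative squares,
"isometries of Frobenius degree `N'/N`", "`α_{N,N'}` of base-Frobenius type" (p.318–319 (PDF pp.92–93)) and the outer
equivariance of the Galois actions along `β^bs` are the INPUTS so named.  [cite: MochizukiEtTh2009, Rmk 4.3.2 p.318–319 (PDF pp.92–93); §5 p.330–331 (PDF pp.104–105)] -/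
def ofBiKummerFamily : ThetaFrobenioidTower.{w} S.C D where
  toTemperedFrobenioidStub := S.sec5Stub h
  toThetaSubquotientStub := Q
  l := lv
  odd_l := odd_l
  Acirc := S.Aodot
  PiX := 𝒯.PiX
  zquot := 𝒯.zquot
  zquot_surjective := 𝒯.zquot_surjective
  PiYdd := 𝒯.PiYdd
  PiYdd_le := 𝒯.ker_zquot.symm ▸ 𝒯.PiYdd_le
  relindex_PiYdd := by rw [𝒯.ker_zquot]; exact 𝒯.index_PiYdd
  PiYdd_normal := 𝒯.PiYdd_normal
  isOpen_PiYdd := 𝒯.PiYdd_open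
  K := K'
  thetaFn := toB S.Aodot θ
  AN N := (R N).AN
  BN N := (R N).BN
  sCap N := (R N).pair.num
  sCup N := (R N).pair.den
  base_map_sCap N := (R N).pair.base_eq
  isPreStep_sCap N := ⟨(R N).pair.isPreStep_num.1, (R N).pair.isPreStep_num.2⟩
  isPreStep_sCup N := ⟨(R N).pair.isPreStep_den.1, (R N).pair.isPreStep_den.2⟩
  ρ := rhoFamily R ιX
  ρ_surjective := rhoFamily_surjective R ιX
  isOpen_ker_ρ N := isOpen_ker_rhoFamily R ιX N (hopen N)
  strv := σ
  sgpCap N := (levelData h toB Q odd_l R ιX hopen σ K' constEmb constEmb_injective hdivc hdivp N).sgpCap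
  sgpCup N := (levelData h toB Q odd_l R ιX hopen σ K' constEmb constEmb_injective hdivc hdivp N).sgpCup
  constEmb := constEmb
  constEmb_injective := constEmb_injective
  α := α
  β := β
  comm_sCap := comm_sCap
  comm_sCup := comm_sCup
  isIsometry_α := isIsometry_α
  degFr_α := degFr_α
  isIsometry_β := isIsometry_β
  degFr_β := degFr_β
  baseFrob_α := baseFrob_α
  ρ_comm_β := ρ_comm_β

/-- **The levels of the assembled tower are the level data** (definitionally).  [cite: MochizukiEtTh2009, §5 p.330 (PDF p.104)] -/
theorem atLevel_ofBiKummerFamily (N : ℕ+) :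
    (ofBiKummerFamily h toB Q odd_l R ιX hopen σ K' constEmb constEmb_injective hdivc hdivp α β comm_sCap comm_sCup
      isIsometry_α degFr_α isIsometry_β degFr_β baseFrob_α ρ_comm_β).atLevel N =
      levelData h toB Q odd_l R ιX hopen σ K' constEmb constEmb_injective hdivc hdivp N := rfl

/-- At `M ∈ E` the tower's level is `ofBiKummerData` over `𝒯.level M`.  [cite: MochizukiEtTh2009, §5 p.330 (PDF p.104)] -/
theorem atLevel_ofBiKummerFamily_eq_ofBiKummerData (M : E) :
    (ofBiKummerFamily h toB Q odd_l R ιX hopen σ K' constEmb constEmb_injective hdivc hdivp α β comm_sCap comm_sCup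
      isIsometry_α degFr_α isIsometry_β degFr_β baseFrob_α ρ_comm_β).atLevel M =
      ThetaFrobenioid.ofBiKummerData (T := 𝒯.level M) h toB Q odd_l (R M) ιX (hopen M) (σ M) K' (constEmb M)
        (constEmb_injective M) (hdivc M) (hdivp M) := rfl

end Transitions

/-! ### The defining relations and the section property at EVERY level `N ≥ 1` -/

/-- `SgpCapSpec` at every level (defining relation of `s^⊓-gp_N`, p.331 (PDF p.105)). [cite: MochizukiEtTh2009, §5 p.331 (PDF p.105)] -/
theorem sgpCapSpec_levelData (N : ℕ+) :
    (levelData h toB Q odd_l R ιX hopen σ K' constEmb constEmb_injective hdivc hdivp N).SgpCapSpec := fun g =>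
  ThetaFrobenioid.liftAlong_spec (𝔉 := levelAux h toB Q odd_l R ιX hopen σ K' constEmb constEmb_injective N)
    (ThetaFrobenioid.epi_of_model (DivB := S.tf.divBNatTrans) h)
    (ModelFrobenioid.ofModel_isOfIsotropicType S.tf.divisorMonoid S.tf.ratFnFunctor S.tf.divBNatTrans h.isGroupLike_rat)
    (ThetaFrobenioid.iiid_sec5Stub h)
    ((levelAux h toB Q odd_l R ιX hopen σ K' constEmb constEmb_injective N).strv.comp
      (levelAux h toB Q odd_l R ιX hopen σ K' constEmb constEmb_injective N).autBaseIsoAB.symm.toMonoidHom)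
    ⟨(R N).pair.isPreStep_num.1, (R N).pair.isPreStep_num.2⟩ (fun g => hdivc N g) g

/-- `SgpCupSpec` at every level (defining relation of `s^⊔-gp_N`, p.331 (PDF p.105)). [cite: MochizukiEtTh2009, §5 p.331 (PDF p.105)] -/
theorem sgpCupSpec_levelData (N : ℕ+) :
    (levelData h toB Q odd_l R ιX hopen σ K' constEmb constEmb_injective hdivc hdivp N).SgpCupSpec := fun hh =>
  ThetaFrobenioid.liftAlong_spec (𝔉 := levelAux h toB Q odd_l R ιX hopen σ K' constEmb constEmb_injective N)
    (ThetaFrobenioid.epi_of_model (DivB := S.tf.divBNatTrans) h)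
    (ModelFrobenioid.ofModel_isOfIsotropicType S.tf.divisorMonoid S.tf.ratFnFunctor S.tf.divBNatTrans h.isGroupLike_rat)
    (ThetaFrobenioid.iiid_sec5Stub h)
    (((levelAux h toB Q odd_l R ιX hopen σ K' constEmb constEmb_injective N).strv.comp
      (levelAux h toB Q odd_l R ιX hopen σ K' constEmb constEmb_injective N).autBaseIsoAB.symm.toMonoidHom).comp
      (levelAux h toB Q odd_l R ιX hopen σ K' constEmb constEmb_injective N).HB.subtype)
    ⟨(R N).pair.isPreStep_den.1, (R N).pair.isPreStep_den.2⟩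
    (div_levelAux_HB h toB Q odd_l R ιX hopen σ K' constEmb constEmb_injective hdivp N) hh

/-- `StrvSection` at every level from the section property of `σ N` ([FrdI] Prop. 5.6).
[cite: MochizukiEtTh2009, §5 p.331 (PDF p.105)] -/
theorem strvSection_levelData (hσ : ∀ (N : ℕ+) (g : Aut (R N).AN.base), ModelFrobenioid.baseMap (σ N g).hom = g.hom)
    (N : ℕ+) : (levelData h toB Q odd_l R ιX hopen σ K' constEmb constEmb_injective hdivc hdivp N).StrvSection :=
  fun g => Aut.ext (hσ N g)

/-- `((s^⊓_N)^bs)⁻¹ ρ_N(y) (s^⊓_N)^bs = ρ_{A_N}(ιX y)` at every level. [cite: MochizukiEtTh2009, §5 p.331 (PDF p.105)] -/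
theorem levelData_autBaseIsoAB_symm_ρ (N : ℕ+) (y : 𝒯.PiX) :
    (levelData h toB Q odd_l R ιX hopen σ K' constEmb constEmb_injective hdivc hdivp N).autBaseIsoAB.symm
        ((levelData h toB Q odd_l R ιX hopen σ K' constEmb constEmb_injective hdivc hdivp N).ρ y) =
      S.galoisSurj (R N).AN.base (R N).αData.isGalois (ιX y) := by
  change (BiKummerSetting.NthRoot.baseIso S (R N)).conjAut.symm
    ((BiKummerSetting.NthRoot.baseIso S (R N)).conjAut (S.galoisSurj (R N).AN.base (R N).αData.isGalois (ιX y))) = _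
  exact MulEquiv.symm_apply_apply _ _

end ThetaFrobenioidTower

end Literature.AnabelianGeometry.EtaleTheta

end
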